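import Summits.CriticalPhenomena.CardyFormulaZ2.Theorems.CardyBondTriangularBondTriangularCardyBlueArmCycleContacts
import HarnessLib

/-!
# Route CardyBondTriangular · crux `BondTriangularCardy` · line `birth`: the blue arm of Claim 10 — blocks of outer right cells; the bump lemma

Helper of the stub `stub_blueArm`; port of `TriClaim10Cycle.lean` (`cyc_block_exit_two`,
`false_of_bump`) to the kite walk. Along a cycle of the kite interface, a maximal block of outer
right cells is seen from the left cells across boundary darts whose positions never decrease
(`trans_out_out`), all yellow, so a block entered across a dart of the stretch `A₂` is left across
a dart of `A₂` (`cyc_block_exit_two`). The bump lemma (`false_of_bump`): if the separating path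
`Q` is the union of a bump `B` (with `w` to its left) and a path `P°` not separating `w`, and the
chord loop of the bump has every face of `A₀` on its right, contradiction — verbatim from the site
version, the non-separation by `P°` being a hypothesis.

## References

* B. Bollobás, O. Riordan, *Percolation*, CUP (2006), Ch. 7, Claim 10 pp. 178–179.
-/

namespace Summit.CriticalPhenomena.CardyFormulaZ2.Theorems.BondTriangularCardyLine.KiteB

open Finset Literature.Probability.Percolation Literature.Probability.LatticeModels

section Block

variable (D : TriMarkedDomain 3) {σ : CLHexConfig} {orb : ℕ → KDart} {N : ℕ}
  (horb : ∀ k < N, succ (kcol D σ) (orb k) = orb (k + 1))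
  (hiface : ∀ k < N, iface (kcol D σ) (orb k) = true) (hadm : ∀ k < N, (orb k).adm = true)
  (hleft : ∀ k < N, (orb k).leftCell ∈ D.verts)

include horb hiface hadm hleft in
/-- **Along a block of outer right cells the darts from the left cells stay in `A₂` once there.** -/
theorem cyc_block_stretch_two {m₁ : ℕ}
    (h2 : D.stretchIdx₃ (D.dpos ((orb m₁).leftCell, (orb m₁).rightCell)) = 2) :
    ∀ n, m₁ + n < N → (∀ i, i ≤ n → (orb (m₁ + i)).rightCell ∉ D.verts) →
      D.stretchIdx₃ (D.dpos ((orb (m₁ + n)).leftCell, (orb (m₁ + n)).rightCell)) = 2 := by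
  intro n
  induction n with
  | zero => intro _ _; simpa using h2
  | succ n ih =>
    intro hn hout
    have ih' := ih (by omega) (fun i hi => hout i (by omega))
    have hk : m₁ + n + 1 < N := by omega
    have ho := hout n (by omega)
    have ho' := hout (n + 1) le_rfl
    rw [show m₁ + (n + 1) = m₁ + n + 1 by omega] at ho' ⊢
    have hG' : (succ (kcol D σ) (orb (m₁ + n))).leftCell ∈ D.verts := by rw [horb _ (by omega)]; exact hleft _ hk
    have htr := trans_out_out (hiface _ (by omega)) (hadm _ (by omega)) (hleft _ (by omega)) hG' ho (by rw [horb _ (by omega)]; exact ho')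
    rw [horb _ (by omega)] at htr
    have hd := (bdry_of_rightCell_out (hiface _ (by omega)) (hadm _ (by omega)) (hleft _ (by omega)) ho).1
    have hne := (bdry_of_rightCell_out (hiface _ hk) (hadm _ hk) (hleft _ hk) ho').2.1
    rcases htr with h | h
    · rw [h]; exact ih'
    · rw [h] at hne ⊢
      exact D.stretchIdx_succ_eq_two hd ih' hne

include horb hiface hadm hleft in
/-- **A block of outer right cells entered across a dart of `A₂` is left across a dart of `A₂`**:
if `ρₖ ∈ G`, `ρ_{k+1}, …, ρ_{k+n} ∉ G`, `ρ_{k+n+1} ∈ G` and the entry dart `ρₖ → ρ_{k+1}` is in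
the stretch `A₂`, then so is the exit dart `ρ_{k+n+1} → ρ_{k+n}`. -/
theorem cyc_block_exit_two {k n : ℕ} (hkn : k + n + 1 < N) (hin : (orb k).rightCell ∈ D.verts)
    (hout : ∀ i, 1 ≤ i → i ≤ n → (orb (k + i)).rightCell ∉ D.verts) (hn : 1 ≤ n)
    (hin' : (orb (k + n + 1)).rightCell ∈ D.verts)
    (h2 : D.stretchIdx₃ (D.dpos ((orb k).rightCell, (orb (k + 1)).rightCell)) = 2) :
    D.stretchIdx₃ (D.dpos ((orb (k + n + 1)).rightCell, (orb (k + n)).rightCell)) = 2 := by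
  have hout1 : (orb (k + 1)).rightCell ∉ D.verts := hout 1 le_rfl hn
  have hG1 : (succ (kcol D σ) (orb k)).leftCell ∈ D.verts := by rw [horb k (by omega)]; exact hleft (k + 1) (by omega)
  obtain ⟨hc₁, -, htr₁⟩ := trans_in_out (hiface k (by omega)) (hadm k (by omega)) (hleft k (by omega)) hG1 hin
    (by rw [horb k (by omega)]; exact hout1)
  rw [horb k (by omega)] at hc₁ htr₁
  -- the first dart from the left cell is in `A₂`
  have hfirst : D.stretchIdx₃ (D.dpos ((orb (k + 1)).leftCell, (orb (k + 1)).rightCell)) = 2 := by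
    have hne := (bdry_of_rightCell_out (hiface (k + 1) (by omega)) (hadm (k + 1) (by omega)) (hleft (k + 1) (by omega)) hout1).2.1
    rcases htr₁ with ⟨hsucc, -, -⟩ | hsame
    · rw [hsucc] at hne ⊢; exact D.stretchIdx_succ_eq_two hc₁ h2 hne
    · rw [hsame]; exact h2
  -- hence all of them, up to `k + n`
  have hlast := cyc_block_stretch_two D horb hiface hadm hleft hfirst (n - 1) (by omega) (fun i hi => by
    rw [show k + 1 + i = k + (1 + i) by omega]; exact hout (1 + i) (by omega) (by omega))
  rw [show k + 1 + (n - 1) = k + n by omega] at hlast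
  -- and the exit dart is the last one or its successor
  have houtn : (orb (k + n)).rightCell ∉ D.verts := hout n hn le_rfl
  have hGn : (succ (kcol D σ) (orb (k + n))).leftCell ∈ D.verts := by rw [horb _ (by omega)]; exact hleft _ hkn
  have htr := trans_out_in (hiface _ (by omega)) (hadm _ (by omega)) (hleft _ (by omega)) hGn houtn
    (by rw [horb _ (by omega)]; exact hin')
  rw [horb _ (by omega)] at htr
  have hd := (bdry_of_rightCell_out (hiface _ (by omega)) (hadm _ (by omega)) (hleft _ (by omega)) houtn).1
  rcases htr with hdive | ⟨hsucc, -, -, hne⟩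
  · rw [hdive]; exact hlast
  · rw [hsucc] at hne ⊢; exact D.stretchIdx_succ_eq_two hd hlast hne

end Block

/-- **The bonds of `G` of a chord loop are the bonds of its path** (registered anchor of this file). -/
theorem exists_cycDarts_chordLoop_iff : ∀ (D : Literature.Probability.Percolation.TriMarkedDomain 3) {X : List (Literature.Probability.LatticeModels.Site 2)}, X ≠ [] → ∀ (nv' len' : ℕ) {x y : Literature.Probability.LatticeModels.Site 2}, x ∈ D.verts → y ∈ D.verts → ((∃ d ∈ Literature.Probability.Percolation.cycDarts (D.chordLoop X nv' len'), s(x, y) = s(d.1, d.2)) ↔ ∃ d ∈ Literature.Probability.Percolation.pathDarts X, s(x, y) = s(d.1, d.2)) := by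
  intro D X hX nv' len' x y hx hy
  constructor
  · rintro ⟨d, hd, he⟩
    have h1 : d.1 ∈ s(x, y) := by rw [he]; exact Sym2.mem_mk_left _ _
    have h2 : d.2 ∈ s(x, y) := by rw [he]; exact Sym2.mem_mk_right _ _
    have h1G : d.1 ∈ D.verts := by rcases Sym2.mem_iff.1 h1 with h | h <;> (rw [h]; assumption)
    have h2G : d.2 ∈ D.verts := by rcases Sym2.mem_iff.1 h2 with h | h <;> (rw [h]; assumption)
    exact ⟨d, D.mem_pathDarts_of_mem_cycDarts_chordLoop hX hd h1G h2G, he⟩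
  · rintro ⟨d, hd, he⟩
    exact ⟨d, D.mem_cycDarts_chordLoop_of_mem_pathDarts (nv := nv') hX len' hd, he⟩

section Bump

variable (D : TriMarkedDomain 3) {w : HexVertex}

/-- **The bump lemma** (`TriClaim10Cycle.false_of_bump` with the non-separation of the
complementary path `P°` as a hypothesis). Let the separating path `Q` be the union of a bump `B`
and a path `P°` sharing one endpoint, with `w` to the left of a dart of `B`, `P°` not separating
`w` from `A₀`, and let the chord loop `Π` of the bump be a lattice loop of sites of `G` having every
face of `A₀` on its right: contradiction (along a dual path from `w` to `A₀` not crossing `P°`,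
the labels with respect to the chord loop of `Q` and to `Π` change together). -/
theorem false_of_bump {Q : List (Site 2)} (hQne : Q ≠ []) (hQG : ∀ s ∈ Q, s ∈ D.verts)
    {nu nv : ℕ} (hnu1 : D.pos 1 ≤ nu) (hnu2 : nu < D.pos 2) (hnv2 : D.pos 2 ≤ nv) (hnvL : nv < #(triBdryDarts D.verts))
    (hC : IsTriLoop (D.chordLoop Q nv (nu + #(triBdryDarts D.verts) - nv)))
    (hπw : faceLabel (cycDarts (D.chordLoop Q nv (nu + #(triBdryDarts D.verts) - nv))) w =
      leftLabel (D.chordLoop Q nv (nu + #(triBdryDarts D.verts) - nv)))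
    {B P₀ : List (Site 2)} (hB : B ≠ [])
    (hE : ∀ e : Sym2 (Site 2), (∃ d ∈ pathDarts Q, e = s(d.1, d.2)) ↔
      (∃ d ∈ pathDarts B, e = s(d.1, d.2)) ∨ (∃ d ∈ pathDarts P₀, e = s(d.1, d.2)))
    (hns : ¬ Separates D.verts {e : Sym2 (Site 2) | ∃ d ∈ pathDarts P₀, e = s(d.1, d.2)} w (D.stretch 0))
    {nvPl lenPl : ℕ} (hPl : IsTriLoop (D.chordLoop B nvPl lenPl))
    (htarget : ∀ F : HexVertex, (∃ d ∈ D.stretch 0, d.1 ∈ hexFaceVertices F ∧ d.2 ∈ hexFaceVertices F) →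
      faceLabel (cycDarts (D.chordLoop B nvPl lenPl)) F = leftLabel (D.chordLoop B nvPl lenPl) + 1)
    {a b : Site 2} (hab : (a, b) ∈ pathDarts B) (hw : leftFace a b = w) : False := by
  -- adapted from `TriClaim10Cycle.false_of_bump` (site version)
  set L := #(triBdryDarts D.verts) with hL
  set C := D.chordLoop Q nv (nu + L - nv) with hCdef
  set Pl := D.chordLoop B nvPl lenPl with hPldef
  have hlen : nv + (nu + L - nv) = nu + L := by omega
  unfold Separates at hns
  push Not at hns
  obtain ⟨F, hF, hreach⟩ := hns
  have hpar : ∀ x y, x ∈ D.verts → y ∈ D.verts →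
      s(x, y) ∉ {e : Sym2 (Site 2) | ∃ d ∈ pathDarts P₀, e = s(d.1, d.2)} →
      lbond (cycDarts C) x y = lbond (cycDarts Pl) x y := by
    intro x y hx hy hnot
    have hnot' : ¬ ∃ d ∈ pathDarts P₀, s(x, y) = s(d.1, d.2) := hnot
    rw [hC.lbond_eq_ite, hPl.lbond_eq_ite, if_congr (exists_cycDarts_chordLoop_iff D hQne _ _ hx hy) rfl rfl,
      if_congr (exists_cycDarts_chordLoop_iff D hB nvPl lenPl hx hy) rfl rfl, if_congr (hE _) rfl rfl]
    simp only [hnot', or_false]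
  have hsum := faceLabel_add_eq_of_reflTransGen_dualStep hC.adj hPl.adj hpar hreach
  have hπF : faceLabel (cycDarts C) F = leftLabel C :=
    D.faceLabel_eq_leftLabel_of_stretch_zero hQne hQG hnu1 hnu2 hnv2 hnvL hlen hC hF
  have hlF := htarget F hF
  have hlw : faceLabel (cycDarts Pl) w = leftLabel Pl := by
    rw [← hw]; exact hPl.faceLabel_leftFace (D.mem_cycDarts_chordLoop_of_mem_pathDarts (nv := nvPl) hB lenPl hab)
  rw [hπw, hπF, hlF, hlw] at hsum
  have key : ∀ a b : ZMod 2, a + b ≠ a + (b + 1) := by decide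
  exact key _ _ hsum

end Bump

end Summit.CriticalPhenomena.CardyFormulaZ2.Theorems.BondTriangularCardyLine.KiteB
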